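import Summits.QuantumFields.YangMills.Theorems.BalabanUVNodesN18HLayerDatumBall
import Summits.QuantumFields.BalabanUV.T4Continuum.Spine.NE5.TwoRunTorusWalkOutputLetters

/-!
# BalabanUVNodes ∕ N18 — file 4's DISPLACED BALL DATA `hU` FROM PER-TERM WALK RECORDS OVER THE DATA SPACE: the walk road T25
# `TwoRunTorusWalkParam.hol_and_h226_torus_of_termWalkData_param` (letters from the records, T28 `TwoRunTorusWalkRePos`)
# ASSEMBLED over the term catalogue, the admissible base points and the scales, in the DATA direction `B := Op × Hist`
# (Track A, DAG node N18 = NE5 `T4OutputRate.NE5 EA EB W κ θ C₅` :211; cluster K4 «SpineRates»; file 5 of seat pub-ymgap-dag-n18-c;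
# the `hH` ∕ `N18At` faces on top of it are file 6 `BalabanUVNodesN18AtWalkRecords`)

HONEST FRAMING.  Count-neutral kernel bookkeeping (seat pub-ymgap-dag-n18-c g2; `--supports stmt-QuantumFields-19676`): pure
composition BY NAME of LANDED shapes — T25 `hol_and_h226_torus_of_termWalkData_param` (one term, any complex parameter space) and
T28 `re_posDef_on_ball_of_termWalkData` ∕ `eigenvalues_le_of_termWalkData` ∕ `gammaForm_le_of_termWalkData` (NODE A's positivity and
the operator letters `c_E`, `g` READ FROM the record + SYMMETRY, exactly as T26′ `TwoRunTorusWalkOutputLetters` does per term).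
Every record, package, region, list, function and number is a HYPOTHESIS: whether Bałaban's (2.14)-terms of `H(Z)`, READ AS
FUNCTIONS OF THE STEP's DATA (operators, inserted history) in the displacement `u = z − p` from an admissible base point `p`, admit
`B13TermWalkData.TermKernels` records with `TermWalkData` and printed constants is NODE O's statement (v) in the data direction —
instance 0∕1, NOT claimed; the symmetry ∕ smallness letters are NODE A's; NE5 NOT IN PRINT ([Balaban1987RG1] Thm 1 p. 259) and
NOT PROVED; NOT a node discharge; one finite four-torus programme at fixed ε; nothing continuum ∕ ℝ⁴ ∕ OS ∕ mass-gap ∕ Clay.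
0 `def`, 0 `sorry`.

THE POINT.  File 4 (`BalabanUVNodesN18HLayerDatumBall`, p455159) reduced route P1's W2 wall for N18 on the carriers of record
`R : B13Carriers.TwoRuns G` to `hU`: per scale and admissible base point `p`, every term of `H(Z)` read in the displacement
`u = z − p` is complex differentiable on `ball 0 (α j)` with (2.26) there — *"T25's output shape at `B := Op × Hist`, walk record
NOT constructed"* (dag-ref-F READ #22).  THIS FILE executes the remaining by-name step: `hU` ITSELF from per-term walk records
over `Op × Hist`, so that the s1 residual of N18 reads, letter for letter, like the binder list of the two-run END
`BalabanUVNodesN18End.n18_family_of_end8` (pencil, `B = ℂ`) and of row (D4) (seam, `B = E`): per (scale, admissible base point,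
term) ONE record `𝒦 : TermKernels c⁺ 4 (R.cubesPerDir j) ν (Nf j) (Op × Hist)` with `TermWalkData 𝒦 (w j)` for ONE admissible
package per scale at a configuration size `α j`, + entrywise σ-holomorphy of `𝒦.A2`, `𝒦.G2` (NODE O: the operators are linear
interpolations (2.4)–(2.6) in σ), SYMMETRY of the precision on the closed `c⁺`-polydisc × closed `α`-ball (NODE A, [II] p. 15),
the potentials `𝐕` with (2.20) on the per-domain τ-regions, the common `χ, χᶜ, 𝐃` with (2.22), a column fibre bound, NODE A's
smallness `SmallTheta` BY NAME, and the p. 17 numerics in the records' letters with `c_E`, `g` constrained from below.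
* §1 `termBallData_of_termWalkData_symm` — ONE torus `T_{N′}`, ANY complex data space `P`, records indexed by the term catalogue
  `terms L M Z`: «every term complex differentiable on `ball 0 α`» ∧ «(2.26) for every term at every point of the ball» — T25
  per term with T28's three derivations, under the identification of the term functions with the (2.14)-display of the
  records (`term214 ∘ core214 ∘ F214`, [II] (2.14) p. 15).
* §2 on the carriers of record, `P := Op × Hist`: `displacedBallData_of_termWalkData_record` — §1 at every scale `j`
  (`N′ = R.cubesPerDir j`) and every admissible base point `p ∈ M.Base j g U`, records `𝒦 j p Z t` (kernels in the displacement
  from `p`) ⟹ file 4's `hU` VERBATIM (the hypothesis of `hH_of_displacedBallData_record` ∕ `n18At_of_displacedBallData_record`).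

Sources: T. Bałaban, CMP **116** (1988) [Balaban1988RG2Cluster] (1.5) p. 3, p. 5 (κ₁), p. 13, p. 15, (2.14)–(2.18) pp. 15–16,
(2.20)–(2.26) pp. 16–17; CMP **99** (1985) [Balaban1985BackgroundPropagators] Thm 3.10 pp. 415–416; CMP **109** (1987) [Balaban1987RG1]
Thm 1 p. 259; C. King, CMP **102** (1986) [King1986] p. 665.  Nothing here is a claim about the Yang–Mills mass gap.
-/

noncomputable section

namespace Summit.QuantumFields.YangMills.BalabanUVNodes.N18HLayerWalkRecords

open Matrix Set Metric Finset
open Literature.MathematicalPhysics.QuantumFieldTheory.Balaban1983to89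
open Literature.MathematicalPhysics.QuantumFieldTheory.Balaban1983to89.T4OutputRate
open Literature.MathematicalPhysics.QuantumFieldTheory.Balaban1983to89.T4InputCauchyRateData
open Literature.MathematicalPhysics.QuantumFieldTheory.Balaban1983to89.TreeLengthTorus (TPt TDom tsys)
open Literature.MathematicalPhysics.QuantumFieldTheory.Balaban1983to89.TreeLengthTorusTransfer (tclosure)
open Literature.MathematicalPhysics.QuantumFieldTheory.Balaban1983to89.B13Lemma3TorusData (TBond)
open Literature.MathematicalPhysics.QuantumFieldTheory.Balaban1983to89.B13Lemma3TorusTerms (terms weight Z0)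
open Literature.MathematicalPhysics.QuantumFieldTheory.Balaban1983to89.B13Term214 (core214 F214 term214)
open Literature.MathematicalPhysics.QuantumFieldTheory.Balaban1983to89.B13Bound143 (invTau)
open Literature.MathematicalPhysics.QuantumFieldTheory.Balaban1983to89.B5TorusCover (UT)
open Literature.MathematicalPhysics.QuantumFieldTheory.Balaban1983to89.B13TermWalkData
  (WalkConsts TermKernels TermWalkData)
open Literature.MathematicalPhysics.QuantumFieldTheory.Balaban1983to89.B13TermWalkDataOneTorus (SmallTheta)
open Summit.QuantumFields.BalabanUV.T4Continuum.B13Carriers (TwoRuns)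
open Summit.QuantumFields.BalabanUV.T4Continuum.Spine.NE5
open Summit.QuantumFields.BalabanUV.T4Continuum.Spine.NE5.TwoRunTorusWalkParam
  (hol_and_h226_torus_of_termWalkData_param)
open Summit.QuantumFields.BalabanUV.T4Continuum.Spine.NE5.TwoRunTorusWalkRePos
  (re_posDef_on_ball_of_termWalkData eigenvalues_le_of_termWalkData gammaForm_le_of_termWalkData)

/-! ## §1 One torus, any complex data space: every term's ball data (hol) + (226) from per-term walk records + symmetry -/

section OneTorus

variable {d L N' : ℕ} [NeZero L] [NeZero N'] {Mb : ℕ} [NeZero Mb]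
variable {ν : ℕ} {Nf : Fin ν → ℕ} [∀ i, NeZero (Nf i)]
variable {P : Type*} [NormedAddCommGroup P] [NormedSpace ℂ P]

open Classical in
/-- **EVERY TERM's BALL DATA (hol) + (226) ALONG ANY COMPLEX DATA SPACE FROM PER-TERM WALK RECORDS AND SYMMETRY, THE OPERATOR
LETTERS READ FROM THE RECORDS** — T25 `hol_and_h226_torus_of_termWalkData_param` at every term `t ∈ terms L M Z` of the torus
model on `T_{N′}`, with (per term) NODE A's positivity `hA`, the spectral letter `hc` and the Γ₀-form letter `hΓq` DERIVED from
the record by T28 (`re_posDef_on_ball_of_termWalkData`, `eigenvalues_le_of_termWalkData`, `gammaForm_le_of_termWalkData`) under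
the envelopes `hcE : K̄_C·m·(1+2∕w.κ)^ν ≤ c_E`, `hgE : c_E·(K̄_Γ·m·(1+2∕w.κ)^ν)² ≤ g` and the positivity smallness
`hsmallRe : θ_E(w,α)·(m·(1+2∕w.κ)^ν)·c_E < 1` — verbatim the per-term block of T26′
`TwoRunTorusWalkOutputLetters.differentiableOn_E_torus_of_records_symm`, WITHOUT the (2.13) layer.  Data: constants `c`
(`κ₁ ≥ 1`, `α₆ ≠ 0`), the (2.18) τ-regions `Uτ Y ⊇ {|τ| ≤ (invTau c (d_k Y))⁻¹}` with `0 < invTau ≤ ½`, contour radius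
`0 < r ≤ e^{κ₁} − 1` with its τ-discs about `[0, 1]` in every `Uτ Y`, enumerations `lZ Z t` of `Z ∖ \overline{Z₀}` and `lD t`
of `𝐃`; PER TERM one record `𝒦 Z t : TermKernels c⁺ d N′ ν Nf P` over the data space `P` with `TermWalkData (𝒦 Z t) w` for ONE
package `w` admissible at configuration size `α > 0`; the Γ-operator linear with kernel `𝒦.G2`; `χ, χᶜ ≥ 0`, `𝐃`-family,
potentials `𝐕`; entrywise σ-holomorphy of `𝒦.A2 · u`, `𝒦.G2 · u` on the open polydisc of radius `e^{κ₁+1}` (NODE O), holomorphy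
of the potentials in `u`, measurability, SYMMETRY of `𝒦.A2 σ u` on the closed `c⁺`-polydisc for `‖u‖ ≤ α` (NODE A); (2.22) with
`q_P ≤ ‖·‖²` and (2.20) on `Π_Y Uτ Y` uniformly in `u ∈ ball 0 α`; fibre bound `m`; rates `w.κ > κ_a > κ_b > κ′ > κ″ > 0`; NODE
A's `SmallTheta w α ϑ` BY NAME; the p. 17 numerics `hθR1le`, `hsmallKθ`, `hαc`, `hsmall`, `hPa`, `hvol` in the record's letters.
IDENTIFICATION `hT`: on the ball the term function IS the (2.14)-display of the record,
`T Z t u = term214 r (lZ Z t) (lD t) (core214 (𝒦 Z t).A2(·,u) (Γ Z t u) (F214 |P| χ χᶜ 𝐃 (𝐕 u))) 0 0`.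
Conclusion: (hol) every `T Z t` is `DifferentiableOn ℂ` on `ball 0 α` ∧ (226) `‖T Z t u‖ ≤ weight L M c Z a t · e^{a₅|Z|}` for
every `u ∈ ball 0 α` and every term — the per-base-point ball data of file 4 (`termData_of_displacedBallData_record`'s `hU` at
one scale and one base point, the data space read in the displacement).
[cite: Balaban1988RG2Cluster, p.5, p.13, p.15, (2.14)–(2.18) pp.15–16, (2.20)–(2.26) pp.16–17; Balaban1985BackgroundPropagators, Thm 3.10 pp.415–416; King1986, p.665] -/
theorem termBallData_of_termWalkData_symm (c : B13.Consts) (hκ₁ : 1 ≤ c.κ₁) (hα₆' : c.α₆ ≠ 0)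
    -- regions, radii, contour radius, parameter lists (common to the family)
    (hpos : ∀ Y : TDom d (L * N'), 0 < invTau c ((tsys d (L * N')).dj Y))
    (hhalf : ∀ Y : TDom d (L * N'), invTau c ((tsys d (L * N')).dj Y) ≤ 1 / 2)
    {Uτ : TDom d (L * N') → Set ℂ} (hUτ : ∀ Y, IsOpen (Uτ Y))
    (hUtau : ∀ Y : TDom d (L * N'), closedBall (0 : ℂ) ((invTau c ((tsys d (L * N')).dj Y))⁻¹) ⊆ Uτ Y)
    {r : ℝ} (hr : 0 < r) (hr' : r ≤ Real.exp c.κ₁ - 1)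
    (hsubτ : ∀ Y, ∀ s ∈ Set.uIcc (0 : ℝ) 1, closedBall (s : ℂ) r ⊆ Uτ Y)
    (lZ : TDom d N' → Finset (TDom d (L * N')) × Finset (TBond d Mb (L * N')) → List (TPt d N'))
    (hlZ : ∀ Z t, (lZ Z t).Nodup ∧ (lZ Z t).toFinset = Z.1 \ tclosure L N' (Z0 Mb t))
    (lD : Finset (TDom d (L * N')) × Finset (TBond d Mb (L * N')) → List (TDom d (L * N')))
    (hlD : ∀ t, (lD t).Nodup ∧ (lD t).toFinset = t.1)
    -- PER-TERM WALK RECORDS AT `c⁺` OVER THE DATA SPACE, ONE ADMISSIBLE PACKAGE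
    (𝒦 : (Z : TDom d N') → Finset (TDom d (L * N')) × Finset (TBond d Mb (L * N')) →
      TermKernels ({ c with κ₁ := c.κ₁ + 1 } : B13.Consts) d N' ν Nf P)
    [∀ Z t, Fintype (𝒦 Z t).C₀] [∀ Z t, DecidableEq (𝒦 Z t).C₀]
    {w : WalkConsts} {α Rσ₀ : ℝ} (hw : w.Admissible α Rσ₀) (hα : 0 < α)
    (h𝒦 : ∀ Z, ∀ t ∈ terms L Mb Z, TermWalkData (𝒦 Z t) w)
    (Γ : (Z : TDom d N') → (t : Finset (TDom d (L * N')) × Finset (TBond d Mb (L * N'))) → P →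
      (TPt d N' → ℂ) → ((𝒦 Z t).Λ ⊕ (𝒦 Z t).C₀ → ℝ) → ((𝒦 Z t).Λ → ℂ))
    (hlin : ∀ Z, ∀ t ∈ terms L Mb Z, ∀ u ∈ ball (0 : P) α, ∀ σ : TPt d N' → ℂ,
      (∀ j, σ j ∈ ball (0 : ℂ) (Real.exp (c.κ₁ + 1))) →
        ∀ X : (𝒦 Z t).Λ ⊕ (𝒦 Z t).C₀ → ℝ, Γ Z t u σ X = (𝒦 Z t).G2 σ u *ᵥ fun j => (X j : ℂ))
    (χY₀ χcP : (Z : TDom d N') → (t : Finset (TDom d (L * N')) × Finset (TBond d Mb (L * N'))) →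
      ((𝒦 Z t).Λ → ℝ) → ℝ)
    (hχ0 : ∀ Z, ∀ t ∈ terms L Mb Z, ∀ Bf, 0 ≤ χY₀ Z t Bf) (hχc0 : ∀ Z, ∀ t ∈ terms L Mb Z, ∀ Bf, 0 ≤ χcP Z t Bf)
    (Dfam : TDom d N' → Finset (TDom d (L * N')) × Finset (TBond d Mb (L * N')) → Finset (TDom d (L * N')))
    (Vk : (Z : TDom d N') → (t : Finset (TDom d (L * N')) × Finset (TBond d Mb (L * N'))) → P →
      TDom d (L * N') → ((𝒦 Z t).Λ → ℝ) → ℂ)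
    -- non-walk data: σ-holomorphy (NODE O), symmetry (NODE A), potentials, measurability
    (hAhol : ∀ Z, ∀ t ∈ terms L Mb Z, ∀ u ∈ ball (0 : P) α, ∀ i j,
      DifferentiableOn ℂ (fun σ => (𝒦 Z t).A2 σ u i j) {σ | ∀ j, σ j ∈ ball (0 : ℂ) (Real.exp (c.κ₁ + 1))})
    (hGhol : ∀ Z, ∀ t ∈ terms L Mb Z, ∀ u ∈ ball (0 : P) α, ∀ i j,
      DifferentiableOn ℂ (fun σ => (𝒦 Z t).G2 σ u i j) {σ | ∀ j, σ j ∈ ball (0 : ℂ) (Real.exp (c.κ₁ + 1))})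
    (hVholb : ∀ Z, ∀ t ∈ terms L Mb Z, ∀ Y Bf, DifferentiableOn ℂ (fun u => Vk Z t u Y Bf) (ball (0 : P) α))
    (hχm : ∀ Z, ∀ t ∈ terms L Mb Z, Measurable (χY₀ Z t))
    (hχcm : ∀ Z, ∀ t ∈ terms L Mb Z, Measurable (χcP Z t))
    (hVm : ∀ Z, ∀ t ∈ terms L Mb Z, ∀ u ∈ ball (0 : P) α, ∀ Y, Measurable (Vk Z t u Y))
    (hAs : ∀ Z, ∀ t ∈ terms L Mb Z, ∀ u : P, ‖u‖ ≤ α → ∀ σ : TPt d N' → ℂ,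
      (∀ j, ‖σ j‖ ≤ Real.exp (c.κ₁ + 1)) → ((𝒦 Z t).A2 σ u).IsSymm)
    -- (2.22) and (2.20), uniform along the data space
    {γ₂ rP a₂₀ w₂₀ : ℝ}
    (qP : (Z : TDom d N') → (t : Finset (TDom d (L * N')) × Finset (TBond d Mb (L * N'))) → ((𝒦 Z t).Λ → ℝ) → ℝ)
    (h222 : ∀ Z, ∀ t ∈ terms L Mb Z, ∀ Bf, χY₀ Z t Bf * χcP Z t Bf ≤
      Real.exp (-(γ₂ / 2 * rP ^ 2 * (t.2.card : ℕ)) + γ₂ / 2 * qP Z t Bf))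
    (hγ₂ : 0 ≤ γ₂) (hqP : ∀ Z, ∀ t ∈ terms L Mb Z, ∀ Bf, qP Z t Bf ≤ Bf ⬝ᵥ Bf) (ha0 : 0 ≤ a₂₀)
    (h220U : ∀ Z, ∀ t ∈ terms L Mb Z, ∀ u ∈ ball (0 : P) α, ∀ τ : TDom d (L * N') → ℂ,
      (∀ Y, τ Y ∈ Uτ Y) → ∀ Bf, ∑ Y ∈ Dfam Z t, ‖τ Y‖ * ‖Vk Z t u Y Bf‖ ≤ a₂₀ / 2 * (Bf ⬝ᵥ Bf) + w₂₀)
    -- a common fibre bound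
    {m : ℕ} (hm : ∀ Z, ∀ t ∈ terms L Mb Z, (𝒦 Z t).m ≤ m)
    (hfibN : ∀ Z, ∀ t ∈ terms L Mb Z, ∀ x : UT Nf, (Finset.univ.filter fun j => (𝒦 Z t).locN j = x).card ≤ m)
    -- one package of rates and the p. 17 numerics in the record's letters
    {κa κb kap' kap'' ϑ : ℝ} (hκa : κa < w.kap) (hκb : κb < κa) (h2 : kap' < κb) (h1 : kap'' < kap')
    (hkap'' : 0 < kap'')
    (hsm : SmallTheta w α ϑ)
    (hθR1le : ∀ Z, ∀ t ∈ terms L Mb Z, ((m : ℝ) * (1 + 2 / (κb - kap')) ^ ν) * (m * (1 + 2 / (kap' - kap'')) ^ ν)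
      * ((2 * w.KbarΓ * Real.exp (-(w.ε * w.Rσ)) + 2 * w.KbarΓ * α / w.R) * w.KbarC * w.KbarΓ
        + w.KbarΓ * (w.KbarC * (2 * w.KbarE * Real.exp (-(w.ε * w.Rσ)) + 2 * w.KbarE * α / w.R)
            * ((𝒦 Z t).m * (1 + 2 / (w.kap - κa)) ^ ν) * w.KbarC * ((𝒦 Z t).m * (1 + 2 / (κa - κb)) ^ ν))
            * w.KbarΓ
        + w.KbarΓ * w.KbarC * (2 * w.KbarΓ * Real.exp (-(w.ε * w.Rσ)) + 2 * w.KbarΓ * α / w.R)) ≤ ϑ)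
    (hsmallKθ : w.KbarC * (m * (1 + 2 / κb) ^ ν) * (ϑ * (m * (1 + 2 / kap'') ^ ν)) < 1)
    -- the operator letters `c_E`, `g` constrained FROM BELOW by the records' letters (T28), and NODE A's smallness
    {cE g : ℝ} (hcE : w.KbarC * (m * (1 + 2 / w.kap) ^ ν) ≤ cE)
    (hgE : cE * (w.KbarΓ * (m * (1 + 2 / w.kap) ^ ν)) ^ 2 ≤ g)
    (hsmallRe : (2 * w.KbarE * Real.exp (-(w.ε * w.Rσ)) + 2 * w.KbarE * α / w.R)
      * (m * (1 + 2 / w.kap) ^ ν) * cE < 1)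
    (hαc : (2 * (ϑ * (m * (1 + 2 / kap'') ^ ν)) + (γ₂ + a₂₀)) * cE ≤ 1 / 2)
    (hsmall : (2 * (ϑ * (m * (1 + 2 / kap'') ^ ν)) + (γ₂ + a₂₀)) * (1 + 2 * cE * g) ≤ 1 / 2)
    {a a₅ : ℝ} (hPa : a ≤ γ₂ * rP ^ 2)
    (hvol : ∀ Z, ∀ t ∈ terms L Mb Z,
      2 * (w.KbarC * (m * (1 + 2 / κb) ^ ν) * (ϑ * (m * (1 + 2 / kap'') ^ ν))
              * (1 + (1 - w.KbarC * (m * (1 + 2 / κb) ^ ν) * (ϑ * (m * (1 + 2 / kap'') ^ ν)))⁻¹) / 2)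
          * (Fintype.card (𝒦 Z t).Λ : ℝ)
        + w₂₀ + (2 * (ϑ * (m * (1 + 2 / kap'') ^ ν)) + (γ₂ + a₂₀)) * cE * (Fintype.card (𝒦 Z t).Λ : ℝ)
        + (2 * (ϑ * (m * (1 + 2 / kap'') ^ ν)) + (γ₂ + a₂₀)) * (1 + 2 * cE * g)
          * (Fintype.card ((𝒦 Z t).Λ ⊕ (𝒦 Z t).C₀) : ℝ)
        ≤ a₅ * ((Z.1).card : ℝ))
    -- the term functions along the data space ARE the (2.14)-display of the records on the ball
    (T : (Z : TDom d N') → Finset (TDom d (L * N')) × Finset (TBond d Mb (L * N')) → P → ℂ)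
    (hT : ∀ Z, ∀ t ∈ terms L Mb Z, ∀ u ∈ ball (0 : P) α, T Z t u =
      term214 r (lZ Z t) (lD t) (core214 (fun σ => (𝒦 Z t).A2 σ u) (Γ Z t u)
        (F214 t.2.card (χY₀ Z t) (χcP Z t) (Dfam Z t) (Vk Z t u))) 0 0) :
    (∀ (Z : TDom d N'), ∀ t ∈ terms L Mb Z, DifferentiableOn ℂ (T Z t) (ball (0 : P) α)) ∧
      ∀ u ∈ ball (0 : P) α, ∀ (Z : TDom d N'), ∀ t ∈ terms L Mb Z,
        ‖T Z t u‖ ≤ weight L Mb c Z a t * Real.exp (a₅ * ((Z.1).card : ℝ)) := by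
  -- the letters from the records (T28): positivity, spectral bound, Γ₀-form bound, per term (verbatim T26′)
  have hα0 : 0 ≤ α := hα.le
  have hKc0 : 0 ≤ (1 + 2 / w.kap) ^ ν := by have := hw.hkap; positivity
  have hθE0 : 0 ≤ 2 * w.KbarE * Real.exp (-(w.ε * w.Rσ)) + 2 * w.KbarE * α / w.R := by
    have := hw.hKbarE; have := hα.trans hw.hαR; positivity
  have hmKc : ∀ Z, ∀ t ∈ terms L Mb Z, ((𝒦 Z t).m : ℝ) * (1 + 2 / w.kap) ^ ν ≤ m * (1 + 2 / w.kap) ^ ν :=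
    fun Z t ht => mul_le_mul_of_nonneg_right (by exact_mod_cast hm Z t ht) hKc0
  have hc0 : 0 ≤ cE := le_trans (by have := hw.hKbarC; positivity) hcE
  have hg : 0 ≤ g := le_trans (by positivity) hgE
  have hc : ∀ Z, ∀ t ∈ terms L Mb Z, ∀ k, (𝒦 Z t).hC.1.eigenvalues k ≤ cE :=
    fun Z t ht k => ((eigenvalues_le_of_termWalkData hw hα0 (h𝒦 Z t ht) k).trans
      (mul_le_mul_of_nonneg_left (hmKc Z t ht) hw.hKbarC)).trans hcE
  have hA : ∀ Z, ∀ t ∈ terms L Mb Z, ∀ u : P, ‖u‖ ≤ α → ∀ σ : TPt d N' → ℂ,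
      (∀ j, ‖σ j‖ ≤ Real.exp (c.κ₁ + 1)) → (((𝒦 Z t).A2 σ u).map Complex.re).PosDef :=
    fun Z t ht => re_posDef_on_ball_of_termWalkData hw hα0 (h𝒦 Z t ht) (hAs Z t ht) (hc Z t ht)
      ((mul_le_mul_of_nonneg_right (mul_le_mul_of_nonneg_left (hmKc Z t ht) hθE0) hc0).trans_lt hsmallRe)
  have hΓq : ∀ Z, ∀ t ∈ terms L Mb Z, ∀ X : (𝒦 Z t).Λ ⊕ (𝒦 Z t).C₀ → ℝ,
      ((𝒦 Z t).Γ₀ *ᵥ X) ⬝ᵥ ((𝒦 Z t).C *ᵥ ((𝒦 Z t).Γ₀ *ᵥ X)) ≤ g * (X ⬝ᵥ X) := by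
    intro Z t ht X
    have hXX : 0 ≤ X ⬝ᵥ X := by
      simp only [dotProduct]; exact Finset.sum_nonneg fun i _ => mul_self_nonneg _
    refine (gammaForm_le_of_termWalkData hw hα0 (h𝒦 Z t ht) (hm Z t ht) (hfibN Z t ht) X).trans
      (mul_le_mul_of_nonneg_right ?_ hXX)
    refine le_trans ?_ hgE
    exact mul_le_mul_of_nonneg_right ((mul_le_mul_of_nonneg_left (hmKc Z t ht) hw.hKbarC).trans hcE) (sq_nonneg _)
  -- the τ-enumerations, re-read with the classical decidability instance of T25's statement (B13Carriers' computable
  -- `DecidableEq (TDom d N)` instance is in scope here; the two `List.toFinset`s agree by `Subsingleton.elim`)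
  have hlD' : ∀ t, (lD t).Nodup ∧ @List.toFinset _ (fun a b => Classical.propDecidable (a = b)) (lD t) = t.1 :=
    fun t => ⟨(hlD t).1, by convert (hlD t).2 using 2⟩
  -- T25 per term, on the (2.14)-display of the record (its statement carries the classical `DecidableEq (TDom d N)`
  -- instance inside `term214`; the context's computable one is bridged below by `Subsingleton.elim`, via `congr!`∕`convert`)
  have key := fun (Z : TDom d N') (t : Finset (TDom d (L * N')) × Finset (TBond d Mb (L * N')))
      (ht : t ∈ terms L Mb Z) =>
    hol_and_h226_torus_of_termWalkData_param c hκ₁ hα₆' Z t hpos hhalf hUτ hUtau hr hr' hsubτ (lZ Z t) (hlZ Z t)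
      (lD t) (hlD' t) (𝒦 Z t) hw hα (h𝒦 Z t ht) (Γ Z t) (hlin Z t ht) (χY₀ Z t) (χcP Z t) (hχ0 Z t ht) (hχc0 Z t ht)
      (Dfam Z t) (Vk Z t) (hAhol Z t ht) (hGhol Z t ht) (hVholb Z t ht) (hχm Z t ht) (hχcm Z t ht) (hVm Z t ht)
      (hAs Z t ht) (hA Z t ht) (qP Z t) (h222 Z t ht) hγ₂ (hqP Z t ht) ha0 (h220U Z t ht) (hm Z t ht) (hfibN Z t ht)
      hκa hκb h2 h1 hkap'' hsm (hθR1le Z t ht) hsmallKθ hc0 (hc Z t ht) hαc hg (hΓq Z t ht) hsmall hPa (hvol Z t ht)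
  -- the term functions agree with the display on the ball
  refine ⟨fun Z t ht => (key Z t ht).1.congr fun u hu => ?_, fun u hu Z t ht => ?_⟩
  · rw [hT Z t ht u hu]
    congr!
  · rw [hT Z t ht u hu]
    convert (key Z t ht).2 u hu using 3

end OneTorus

/-! ## §2 On the carriers of record, `P := Op × Hist`: file 4's `hU` from per-base-point walk records -/

section Record

variable {G : Type} [GaugeGroup G] (R : TwoRuns G)
variable {Op Hist : Type*} [NormedAddCommGroup Op] [NormedSpace ℂ Op] [NormedAddCommGroup Hist] [NormedSpace ℂ Hist]
variable {L Mb : ℕ} [NeZero L] [NeZero Mb] (c : B13.Consts) {a a₅ : ℝ}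
variable {ν : ℕ} {Nf : ℕ → Fin ν → ℕ} [∀ j i, NeZero (Nf j i)]

/-- **FILE 4's DISPLACED BALL DATA `hU` FROM PER-BASE-POINT WALK RECORDS OVER THE DATA SPACE** — §1 at every scale `j` (torus
`T_{N′}`, `N′ = R.cubesPerDir j`, fine cover `UT (Nf j)`) and every admissible base point `p ∈ M.Base j g U` of the step model,
with the data space `P := Op × Hist` READ IN THE DISPLACEMENT `u = z − p` (the records' references `Γ₀ = G(0,0)`, `C = A(0,0)⁻¹`
are then the REAL operators AT `p`, [II] p. 15).  Data per scale: the (2.18) τ-regions, the enumerations, ONE admissible package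
`w j` at configuration size `α j > 0`; per (scale, base point, term): the record `𝒦 j p Z t : TermKernels c⁺ 4 (R.cubesPerDir j)
ν (Nf j) (Op × Hist)` with `TermWalkData` (asked at ADMISSIBLE base points only), its Γ-operator, `χ, χᶜ, 𝐃, 𝐕, q_P`, the
non-walk letters (σ-holomorphy, SYMMETRY, (2.20), (2.22), measurability, fibre bound) and the p. 17 numerics `hθR1le`, `hvol`;
uniformly: rates, `SmallTheta (w j) (α j) ϑ`, `hsmallKθ`, the envelopes `hcE`, `hgE`, `hsmallRe`, `hαc`, `hsmall`, `hPa`.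
IDENTIFICATION `hT`: around every admissible base point the step's term functions `T j Z t` (file 1's ∕ file 4's) ARE the
(2.14)-display of the records in the displacement, `T j Z t (p + u) = term214 r (lZ j Z t) (lD j t) (core214 (𝒦 j p Z t).A2(·,u)
(Γ j p Z t u) (F214 …)) 0 0` on `ball 0 (α j)`.  Conclusion: the hypothesis `hU` of file 4's
`N18HLayerDatumBall.hH_of_displacedBallData_record` ∕ `termData_of_displacedBallData_record` VERBATIM.
[cite: Balaban1988RG2Cluster, p.5, p.13, p.15, (2.14)–(2.18) pp.15–16, (2.20)–(2.26) pp.16–17; Balaban1985BackgroundPropagators, Thm 3.10 pp.415–416] -/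
theorem displacedBallData_of_termWalkData_record (M : StepModel R.carriers Op Hist) (hκ₁ : 1 ≤ c.κ₁) (hα₆' : c.α₆ ≠ 0)
    -- per scale: the (2.18) τ-regions, the contour radius, the enumerations
    (hpos : ∀ j, ∀ Y : TDom 4 (L * R.cubesPerDir j), 0 < invTau c ((tsys 4 (L * R.cubesPerDir j)).dj Y))
    (hhalf : ∀ j, ∀ Y : TDom 4 (L * R.cubesPerDir j), invTau c ((tsys 4 (L * R.cubesPerDir j)).dj Y) ≤ 1 / 2)
    {Uτ : (j : ℕ) → TDom 4 (L * R.cubesPerDir j) → Set ℂ} (hUτ : ∀ j Y, IsOpen (Uτ j Y))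
    (hUtau : ∀ j, ∀ Y : TDom 4 (L * R.cubesPerDir j),
      closedBall (0 : ℂ) ((invTau c ((tsys 4 (L * R.cubesPerDir j)).dj Y))⁻¹) ⊆ Uτ j Y)
    {r : ℝ} (hr : 0 < r) (hr' : r ≤ Real.exp c.κ₁ - 1)
    (hsubτ : ∀ j Y, ∀ s ∈ Set.uIcc (0 : ℝ) 1, closedBall (s : ℂ) r ⊆ Uτ j Y)
    (lZ : (j : ℕ) → TDom 4 (R.cubesPerDir j) →
      Finset (TDom 4 (L * R.cubesPerDir j)) × Finset (TBond 4 Mb (L * R.cubesPerDir j)) → List (TPt 4 (R.cubesPerDir j)))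
    (hlZ : ∀ j Z t, (lZ j Z t).Nodup ∧ (lZ j Z t).toFinset = Z.1 \ tclosure L (R.cubesPerDir j) (Z0 Mb t))
    (lD : (j : ℕ) → Finset (TDom 4 (L * R.cubesPerDir j)) × Finset (TBond 4 Mb (L * R.cubesPerDir j)) →
      List (TDom 4 (L * R.cubesPerDir j)))
    (hlD : ∀ j t, (lD j t).Nodup ∧ (lD j t).toFinset = t.1)
    -- PER SCALE, PER BASE POINT, PER TERM: THE WALK RECORDS AT `c⁺` OVER THE DATA SPACE (kernels in the displacement from `p`)
    (𝒦 : (j : ℕ) → Op × Hist → (Z : TDom 4 (R.cubesPerDir j)) →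
      Finset (TDom 4 (L * R.cubesPerDir j)) × Finset (TBond 4 Mb (L * R.cubesPerDir j)) →
      TermKernels ({ c with κ₁ := c.κ₁ + 1 } : B13.Consts) 4 (R.cubesPerDir j) ν (Nf j) (Op × Hist))
    [∀ j p Z t, Fintype (𝒦 j p Z t).C₀] [∀ j p Z t, DecidableEq (𝒦 j p Z t).C₀]
    {W : Set (ℕ → ℝ)} {w : ℕ → WalkConsts} {α Rσ₀ : ℕ → ℝ} (hw : ∀ j, (w j).Admissible (α j) (Rσ₀ j))
    (hα : ∀ j, 0 < α j)
    (h𝒦 : ∀ j, ∀ g ∈ W, ∀ (U : R.carriers.BgB) (p : Op × Hist), p ∈ M.Base j g U →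
      ∀ Z, ∀ t ∈ terms L Mb Z, TermWalkData (𝒦 j p Z t) (w j))
    (Γ : (j : ℕ) → (p : Op × Hist) → (Z : TDom 4 (R.cubesPerDir j)) →
      (t : Finset (TDom 4 (L * R.cubesPerDir j)) × Finset (TBond 4 Mb (L * R.cubesPerDir j))) → Op × Hist →
      (TPt 4 (R.cubesPerDir j) → ℂ) → ((𝒦 j p Z t).Λ ⊕ (𝒦 j p Z t).C₀ → ℝ) → ((𝒦 j p Z t).Λ → ℂ))
    (hlin : ∀ j, ∀ g ∈ W, ∀ (U : R.carriers.BgB) (p : Op × Hist), p ∈ M.Base j g U → ∀ Z, ∀ t ∈ terms L Mb Z,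
      ∀ u ∈ ball (0 : Op × Hist) (α j), ∀ σ : TPt 4 (R.cubesPerDir j) → ℂ,
      (∀ i, σ i ∈ ball (0 : ℂ) (Real.exp (c.κ₁ + 1))) →
        ∀ X : (𝒦 j p Z t).Λ ⊕ (𝒦 j p Z t).C₀ → ℝ, Γ j p Z t u σ X = (𝒦 j p Z t).G2 σ u *ᵥ fun i => (X i : ℂ))
    (χY₀ χcP : (j : ℕ) → (p : Op × Hist) → (Z : TDom 4 (R.cubesPerDir j)) →
      (t : Finset (TDom 4 (L * R.cubesPerDir j)) × Finset (TBond 4 Mb (L * R.cubesPerDir j))) → ((𝒦 j p Z t).Λ → ℝ) → ℝ)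
    (hχ0 : ∀ j, ∀ g ∈ W, ∀ (U : R.carriers.BgB) (p : Op × Hist), p ∈ M.Base j g U → ∀ Z, ∀ t ∈ terms L Mb Z, ∀ Bf,
      0 ≤ χY₀ j p Z t Bf)
    (hχc0 : ∀ j, ∀ g ∈ W, ∀ (U : R.carriers.BgB) (p : Op × Hist), p ∈ M.Base j g U → ∀ Z, ∀ t ∈ terms L Mb Z, ∀ Bf,
      0 ≤ χcP j p Z t Bf)
    (Dfam : (j : ℕ) → Op × Hist → TDom 4 (R.cubesPerDir j) →
      Finset (TDom 4 (L * R.cubesPerDir j)) × Finset (TBond 4 Mb (L * R.cubesPerDir j)) → Finset (TDom 4 (L * R.cubesPerDir j)))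
    (Vk : (j : ℕ) → (p : Op × Hist) → (Z : TDom 4 (R.cubesPerDir j)) →
      (t : Finset (TDom 4 (L * R.cubesPerDir j)) × Finset (TBond 4 Mb (L * R.cubesPerDir j))) → Op × Hist →
      TDom 4 (L * R.cubesPerDir j) → ((𝒦 j p Z t).Λ → ℝ) → ℂ)
    -- non-walk data at admissible base points: σ-holomorphy (NODE O), symmetry (NODE A), potentials, measurability
    (hAhol : ∀ j, ∀ g ∈ W, ∀ (U : R.carriers.BgB) (p : Op × Hist), p ∈ M.Base j g U → ∀ Z, ∀ t ∈ terms L Mb Z,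
      ∀ u ∈ ball (0 : Op × Hist) (α j), ∀ i i',
      DifferentiableOn ℂ (fun σ => (𝒦 j p Z t).A2 σ u i i') {σ | ∀ i, σ i ∈ ball (0 : ℂ) (Real.exp (c.κ₁ + 1))})
    (hGhol : ∀ j, ∀ g ∈ W, ∀ (U : R.carriers.BgB) (p : Op × Hist), p ∈ M.Base j g U → ∀ Z, ∀ t ∈ terms L Mb Z,
      ∀ u ∈ ball (0 : Op × Hist) (α j), ∀ i i',
      DifferentiableOn ℂ (fun σ => (𝒦 j p Z t).G2 σ u i i') {σ | ∀ i, σ i ∈ ball (0 : ℂ) (Real.exp (c.κ₁ + 1))})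
    (hVholb : ∀ j, ∀ g ∈ W, ∀ (U : R.carriers.BgB) (p : Op × Hist), p ∈ M.Base j g U → ∀ Z, ∀ t ∈ terms L Mb Z, ∀ Y Bf,
      DifferentiableOn ℂ (fun u => Vk j p Z t u Y Bf) (ball (0 : Op × Hist) (α j)))
    (hχm : ∀ j, ∀ g ∈ W, ∀ (U : R.carriers.BgB) (p : Op × Hist), p ∈ M.Base j g U → ∀ Z, ∀ t ∈ terms L Mb Z,
      Measurable (χY₀ j p Z t))
    (hχcm : ∀ j, ∀ g ∈ W, ∀ (U : R.carriers.BgB) (p : Op × Hist), p ∈ M.Base j g U → ∀ Z, ∀ t ∈ terms L Mb Z,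
      Measurable (χcP j p Z t))
    (hVm : ∀ j, ∀ g ∈ W, ∀ (U : R.carriers.BgB) (p : Op × Hist), p ∈ M.Base j g U → ∀ Z, ∀ t ∈ terms L Mb Z,
      ∀ u ∈ ball (0 : Op × Hist) (α j), ∀ Y, Measurable (Vk j p Z t u Y))
    (hAs : ∀ j, ∀ g ∈ W, ∀ (U : R.carriers.BgB) (p : Op × Hist), p ∈ M.Base j g U → ∀ Z, ∀ t ∈ terms L Mb Z,
      ∀ u : Op × Hist, ‖u‖ ≤ α j → ∀ σ : TPt 4 (R.cubesPerDir j) → ℂ,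
      (∀ i, ‖σ i‖ ≤ Real.exp (c.κ₁ + 1)) → ((𝒦 j p Z t).A2 σ u).IsSymm)
    -- (2.22) and (2.20), uniform along the data space
    {γ₂ rP a₂₀ w₂₀ : ℝ}
    (qP : (j : ℕ) → (p : Op × Hist) → (Z : TDom 4 (R.cubesPerDir j)) →
      (t : Finset (TDom 4 (L * R.cubesPerDir j)) × Finset (TBond 4 Mb (L * R.cubesPerDir j))) → ((𝒦 j p Z t).Λ → ℝ) → ℝ)
    (h222 : ∀ j, ∀ g ∈ W, ∀ (U : R.carriers.BgB) (p : Op × Hist), p ∈ M.Base j g U → ∀ Z, ∀ t ∈ terms L Mb Z, ∀ Bf,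
      χY₀ j p Z t Bf * χcP j p Z t Bf ≤ Real.exp (-(γ₂ / 2 * rP ^ 2 * (t.2.card : ℕ)) + γ₂ / 2 * qP j p Z t Bf))
    (hγ₂ : 0 ≤ γ₂)
    (hqP : ∀ j, ∀ g ∈ W, ∀ (U : R.carriers.BgB) (p : Op × Hist), p ∈ M.Base j g U → ∀ Z, ∀ t ∈ terms L Mb Z, ∀ Bf,
      qP j p Z t Bf ≤ Bf ⬝ᵥ Bf)
    (ha0 : 0 ≤ a₂₀)
    (h220U : ∀ j, ∀ g ∈ W, ∀ (U : R.carriers.BgB) (p : Op × Hist), p ∈ M.Base j g U → ∀ Z, ∀ t ∈ terms L Mb Z,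
      ∀ u ∈ ball (0 : Op × Hist) (α j), ∀ τ : TDom 4 (L * R.cubesPerDir j) → ℂ, (∀ Y, τ Y ∈ Uτ j Y) →
        ∀ Bf, ∑ Y ∈ Dfam j p Z t, ‖τ Y‖ * ‖Vk j p Z t u Y Bf‖ ≤ a₂₀ / 2 * (Bf ⬝ᵥ Bf) + w₂₀)
    -- a common fibre bound
    {m : ℕ} (hm : ∀ j, ∀ g ∈ W, ∀ (U : R.carriers.BgB) (p : Op × Hist), p ∈ M.Base j g U → ∀ Z, ∀ t ∈ terms L Mb Z,
      (𝒦 j p Z t).m ≤ m)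
    (hfibN : ∀ j, ∀ g ∈ W, ∀ (U : R.carriers.BgB) (p : Op × Hist), p ∈ M.Base j g U → ∀ Z, ∀ t ∈ terms L Mb Z,
      ∀ x : UT (Nf j), (Finset.univ.filter fun i => (𝒦 j p Z t).locN i = x).card ≤ m)
    -- one package of rates, NODE A's smallness BY NAME per scale, the p. 17 numerics in the records' letters
    {κa κb kap' kap'' ϑ : ℝ} (hκa : ∀ j, κa < (w j).kap) (hκb : κb < κa) (h2 : kap' < κb) (h1 : kap'' < kap')
    (hkap'' : 0 < kap'')
    (hsm : ∀ j, SmallTheta (w j) (α j) ϑ)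
    (hθR1le : ∀ j, ∀ g ∈ W, ∀ (U : R.carriers.BgB) (p : Op × Hist), p ∈ M.Base j g U → ∀ Z, ∀ t ∈ terms L Mb Z,
      ((m : ℝ) * (1 + 2 / (κb - kap')) ^ ν) * (m * (1 + 2 / (kap' - kap'')) ^ ν)
      * ((2 * (w j).KbarΓ * Real.exp (-((w j).ε * (w j).Rσ)) + 2 * (w j).KbarΓ * α j / (w j).R) * (w j).KbarC
          * (w j).KbarΓ
        + (w j).KbarΓ * ((w j).KbarC * (2 * (w j).KbarE * Real.exp (-((w j).ε * (w j).Rσ))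
            + 2 * (w j).KbarE * α j / (w j).R)
            * ((𝒦 j p Z t).m * (1 + 2 / ((w j).kap - κa)) ^ ν) * (w j).KbarC
            * ((𝒦 j p Z t).m * (1 + 2 / (κa - κb)) ^ ν)) * (w j).KbarΓ
        + (w j).KbarΓ * (w j).KbarC * (2 * (w j).KbarΓ * Real.exp (-((w j).ε * (w j).Rσ))
            + 2 * (w j).KbarΓ * α j / (w j).R)) ≤ ϑ)
    (hsmallKθ : ∀ j, (w j).KbarC * (m * (1 + 2 / κb) ^ ν) * (ϑ * (m * (1 + 2 / kap'') ^ ν)) < 1)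
    {cE gΓ : ℝ} (hcE : ∀ j, (w j).KbarC * (m * (1 + 2 / (w j).kap) ^ ν) ≤ cE)
    (hgE : ∀ j, cE * ((w j).KbarΓ * (m * (1 + 2 / (w j).kap) ^ ν)) ^ 2 ≤ gΓ)
    (hsmallRe : ∀ j, (2 * (w j).KbarE * Real.exp (-((w j).ε * (w j).Rσ)) + 2 * (w j).KbarE * α j / (w j).R)
      * (m * (1 + 2 / (w j).kap) ^ ν) * cE < 1)
    (hαc : (2 * (ϑ * (m * (1 + 2 / kap'') ^ ν)) + (γ₂ + a₂₀)) * cE ≤ 1 / 2)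
    (hsmall : (2 * (ϑ * (m * (1 + 2 / kap'') ^ ν)) + (γ₂ + a₂₀)) * (1 + 2 * cE * gΓ) ≤ 1 / 2)
    (hPa : a ≤ γ₂ * rP ^ 2)
    (hvol : ∀ j, ∀ g ∈ W, ∀ (U : R.carriers.BgB) (p : Op × Hist), p ∈ M.Base j g U → ∀ Z, ∀ t ∈ terms L Mb Z,
      2 * ((w j).KbarC * (m * (1 + 2 / κb) ^ ν) * (ϑ * (m * (1 + 2 / kap'') ^ ν))
              * (1 + (1 - (w j).KbarC * (m * (1 + 2 / κb) ^ ν) * (ϑ * (m * (1 + 2 / kap'') ^ ν)))⁻¹) / 2)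
          * (Fintype.card (𝒦 j p Z t).Λ : ℝ)
        + w₂₀ + (2 * (ϑ * (m * (1 + 2 / kap'') ^ ν)) + (γ₂ + a₂₀)) * cE * (Fintype.card (𝒦 j p Z t).Λ : ℝ)
        + (2 * (ϑ * (m * (1 + 2 / kap'') ^ ν)) + (γ₂ + a₂₀)) * (1 + 2 * cE * gΓ)
          * (Fintype.card ((𝒦 j p Z t).Λ ⊕ (𝒦 j p Z t).C₀) : ℝ)
        ≤ a₅ * ((Z.1).card : ℝ))
    -- the step's term functions (file 1 ∕ file 4) ARE the (2.14)-display of the records, in the displacement from `p`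
    (T : (j : ℕ) → (Z : TDom 4 (R.cubesPerDir j)) →
      Finset (TDom 4 (L * R.cubesPerDir j)) × Finset (TBond 4 Mb (L * R.cubesPerDir j)) → Op × Hist → ℂ)
    (hT : ∀ j, ∀ g ∈ W, ∀ (U : R.carriers.BgB) (p : Op × Hist), p ∈ M.Base j g U → ∀ Z, ∀ t ∈ terms L Mb Z,
      ∀ u ∈ ball (0 : Op × Hist) (α j), T j Z t (p + u) =
        term214 r (lZ j Z t) (lD j t) (core214 (fun σ => (𝒦 j p Z t).A2 σ u) (Γ j p Z t u)
          (F214 t.2.card (χY₀ j p Z t) (χcP j p Z t) (Dfam j p Z t) (Vk j p Z t u))) 0 0) :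
    ∀ j, ∀ g ∈ W, ∀ (U : R.carriers.BgB) (p : Op × Hist), p ∈ M.Base j g U →
      (∀ (Z : TDom 4 (R.cubesPerDir j)), ∀ t ∈ terms L Mb Z,
        DifferentiableOn ℂ (fun u : Op × Hist => T j Z t (p + u)) (ball 0 (α j))) ∧
      (∀ u ∈ ball (0 : Op × Hist) (α j), ∀ (Z : TDom 4 (R.cubesPerDir j)), ∀ t ∈ terms L Mb Z,
        ‖T j Z t (p + u)‖ ≤ weight L Mb c Z a t * Real.exp (a₅ * ((Z.1).card : ℝ))) :=
  fun j g hg U p hp =>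
  termBallData_of_termWalkData_symm c hκ₁ hα₆' (hpos j) (hhalf j) (hUτ j) (hUtau j) hr hr' (hsubτ j) (lZ j) (hlZ j) (lD j)
    (hlD j) (𝒦 j p) (hw j) (hα j) (h𝒦 j g hg U p hp) (Γ j p) (hlin j g hg U p hp) (χY₀ j p) (χcP j p)
    (hχ0 j g hg U p hp) (hχc0 j g hg U p hp) (Dfam j p) (Vk j p) (hAhol j g hg U p hp) (hGhol j g hg U p hp)
    (hVholb j g hg U p hp) (hχm j g hg U p hp) (hχcm j g hg U p hp) (hVm j g hg U p hp) (hAs j g hg U p hp) (qP j p)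
    (h222 j g hg U p hp) hγ₂ (hqP j g hg U p hp) ha0 (h220U j g hg U p hp) (hm j g hg U p hp) (hfibN j g hg U p hp)
    (hκa j) hκb h2 h1 hkap'' (hsm j) (hθR1le j g hg U p hp) (hsmallKθ j) (hcE j) (hgE j) (hsmallRe j) hαc hsmall hPa
    (hvol j g hg U p hp) (fun Z t u => T j Z t (p + u)) (hT j g hg U p hp)
end Record


end Summit.QuantumFields.YangMills.BalabanUVNodes.N18HLayerWalkRecords

end
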